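import Mathlib.FieldTheory.IntermediateField.Adjoin.Basic
import Mathlib.FieldTheory.SplittingField.IsSplittingField
import Mathlib.FieldTheory.Normal.Basic
import Mathlib.FieldTheory.IsAlgClosed.AlgebraicClosure
import Mathlib.RingTheory.Algebraic.Basic
import HarnessLib

/-!
# An explicit field `K(β) ⊆ K̄` from a full list of roots: normality and its automorphisms

`Proofs` file (theorems only, no definitions, no named facts) in topic
`NumberTheory/GaloisRepresentations`, landed by the seat of bsd.S15
(`Literature.NumberTheory.EllipticCurves.conductorNorm_eq_artinConductorNat_of_isElliptic`): the
field-theoretic part of the explicit-field route.  A computer algebra system presents a normal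
number field as `F = K(β)` with a polynomial `g` (`g(β) = 0`) and the list of all roots
`r_1 = β, …, r_n` of `g` inside `F` as polynomials in `β`; once `deg g = [F : K]` is known (for us
from ramification, `finrank_eq_of_certificates`, so that no irreducibility proof is needed):

* `minpoly_eq_of_natDegree_eq_finrank` — `g = minpoly_K β`;
* `adjoin_simple_eq_adjoin_rootSet`, `normal_adjoin_simple_of_roots` — `K(β) = K(roots of g)` is
  normal over `K` (a splitting field of `g`);
* `exists_algEquiv_apply_gen_eq` — for each `j` there is an automorphism `τ_j` of `K(β)/K` with
  `τ_j(β) = r_j`, these are pairwise distinct and exhaust `Aut(K(β)/K)`;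
  `coe_algEquiv_aeval_gen` — `τ(p(β)) = p(τβ)` read in `K̄` (and `(p(gen) : K̄) = p(β)` is Mathlib's
  `IntermediateField.AdjoinSimple.coe_aeval_gen_apply`).

## References

* S. Lang, *Algebra*, 3rd ed., Ch. V §3–§4 (splitting fields, embeddings of simple extensions).
  [folklore]

## Design

Theorems only, over any field `K`, inside
`E = AlgebraicClosure K`; `F = K⟮β⟯` is Mathlib's `IntermediateField.adjoin K {β}`.  Axioms:
`propext`, `Classical.choice`, `Quot.sound`.
-/

noncomputable section

open scoped Classical Polynomial IntermediateField
open Polynomial IntermediateField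

namespace Literature.NumberTheory.GaloisRepresentations

variable {K : Type*} [Field K]

local notation "E" => AlgebraicClosure K

/-- If `g` is monic with `g(β) = 0` and `deg g = [K(β) : K]`, then `g` is the minimal polynomial of
`β`. [folklore] -/
theorem minpoly_eq_of_natDegree_eq_finrank {β : E} {g : K[X]} (hg : g.Monic) (hβ : aeval β g = 0)
    (hdeg : g.natDegree = Module.finrank K K⟮β⟯) : minpoly K β = g := by
  have hint : IsIntegral K β := Algebra.IsIntegral.isIntegral β
  have hdvd : minpoly K β ∣ g := minpoly.dvd K β hβ
  rw [adjoin.finrank hint] at hdeg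
  exact (Polynomial.eq_of_monic_of_dvd_of_natDegree_le (minpoly.monic hint) hg hdvd hdeg.le).symm

/-- **The root set of `g` is the given list** `r_1, …, r_n` (`n = deg g`, the `r_j` pairwise distinct
roots of `g`). [folklore] -/
theorem rootSet_eq_range {g : K[X]} (hg : g.Monic) {n : ℕ} (hn : g.natDegree = n) {r : Fin n → E}
    (hr : ∀ j, aeval (r j) g = 0) (hinj : Function.Injective r) :
    g.rootSet E = Set.range r := by
  have hg0 : g ≠ 0 := hg.ne_zero
  symm
  apply Set.eq_of_subset_of_ncard_le
  · rintro _ ⟨j, rfl⟩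
    exact (mem_rootSet_of_ne hg0).mpr (hr j)
  · rw [Set.ncard_range_of_injective hinj, Nat.card_eq_fintype_card, Fintype.card_fin, ← hn]
    rw [rootSet, Set.ncard_coe_finset]
    exact le_trans (Multiset.toFinset_card_le _) (le_trans (card_roots' _) (natDegree_map_le))
  · exact (g.rootSet_finite E)

/-- **`K(β) = K(roots of g)`** when all the roots lie in `K(β)` and `β` is one of them. [folklore] -/
theorem adjoin_simple_eq_adjoin_rootSet {β : E} {g : K[X]} (hg : g.Monic) {n : ℕ}
    (hn : g.natDegree = n) {r : Fin n → E} (hr : ∀ j, aeval (r j) g = 0)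
    (hinj : Function.Injective r) (hrF : ∀ j, r j ∈ K⟮β⟯) {j₀ : Fin n} (hβ : r j₀ = β) :
    K⟮β⟯ = adjoin K (g.rootSet E) := by
  rw [rootSet_eq_range hg hn hr hinj]
  apply le_antisymm
  · apply adjoin_le_iff.mpr
    rintro _ rfl
    exact subset_adjoin K _ ⟨j₀, hβ⟩
  · apply adjoin_le_iff.mpr
    rintro _ ⟨j, rfl⟩
    exact hrF j

/-- **`K(β)` is normal over `K`** (a splitting field of `g` inside `K̄`). [folklore] -/
theorem normal_adjoin_simple_of_roots {β : E} {g : K[X]} (hg : g.Monic) {n : ℕ}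
    (hn : g.natDegree = n) {r : Fin n → E} (hr : ∀ j, aeval (r j) g = 0)
    (hinj : Function.Injective r) (hrF : ∀ j, r j ∈ K⟮β⟯) {j₀ : Fin n} (hβ : r j₀ = β) :
    Normal K K⟮β⟯ := by
  rw [adjoin_simple_eq_adjoin_rootSet hg hn hr hinj hrF hβ]
  haveI := adjoin_rootSet_isSplittingField (K := K) (L := E) (p := g)
    (IsAlgClosed.splits (g.map (algebraMap K E)))
  exact Normal.of_isSplittingField g

/-- **The automorphisms of `K(β)/K` from the roots.**  With `K(β)/K` normal (e.g.
`normal_adjoin_simple_of_roots`), `g = minpoly_K β` of degree `n` (`deg g = [K(β) : K]`) and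
`r_1, …, r_n ∈ K(β)` its distinct roots: for every `j` there is `τ_j ∈ Aut(K(β)/K)` with
`τ_j(β) = r_j` (conjugates lie in one orbit, `Normal.minpoly_eq_iff_mem_orbit`); the `τ_j` are
pairwise distinct and, as `#Aut(K(β)/K) ≤ [K(β) : K] = n`, every automorphism is one of them.
[folklore] -/
theorem exists_algEquiv_apply_gen_eq {β : E} [Normal K K⟮β⟯] {g : K[X]} (hg : g.Monic) {n : ℕ}
    (hn : g.natDegree = n) (hdeg : g.natDegree = Module.finrank K K⟮β⟯) (hβ : aeval β g = 0)
    {r : Fin n → E} (hr : ∀ j, aeval (r j) g = 0) (hinj : Function.Injective r)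
    (hrF : ∀ j, r j ∈ K⟮β⟯) :
    ∃ τ : Fin n → (K⟮β⟯ ≃ₐ[K] K⟮β⟯),
      (∀ j, ((τ j (AdjoinSimple.gen K β) : K⟮β⟯) : E) = r j) ∧ Function.Bijective τ := by
  have hint : IsIntegral K β := Algebra.IsIntegral.isIntegral β
  have hmin : minpoly K β = g := minpoly_eq_of_natDegree_eq_finrank hg hβ hdeg
  have hirr : Irreducible g := hmin ▸ minpoly.irreducible hint
  -- each `⟨r j, _⟩ ∈ K⟮β⟯` is a conjugate of the generator
  have hconj : ∀ j, minpoly K (⟨r j, hrF j⟩ : K⟮β⟯) = minpoly K (AdjoinSimple.gen K β) := by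
    intro j
    rw [IntermediateField.minpoly_gen, hmin,
      ← minpoly.algebraMap_eq (algebraMap K⟮β⟯ E).injective (⟨r j, hrF j⟩ : K⟮β⟯)]
    exact (minpoly.eq_of_irreducible_of_monic hirr (hr j) hg).symm
  have hex : ∀ j, ∃ τ : K⟮β⟯ ≃ₐ[K] K⟮β⟯, τ (AdjoinSimple.gen K β) = ⟨r j, hrF j⟩ := by
    intro j
    have hmem : (⟨r j, hrF j⟩ : K⟮β⟯) ∈
        MulAction.orbit (K⟮β⟯ ≃ₐ[K] K⟮β⟯) (AdjoinSimple.gen K β) :=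
      (Normal.minpoly_eq_iff_mem_orbit (F := K) K⟮β⟯).mp (hconj j)
    obtain ⟨τ, hτ⟩ := MulAction.mem_orbit_iff.mp hmem
    exact ⟨τ, hτ⟩
  choose τ hτ using hex
  have hτgen : ∀ j, ((τ j (AdjoinSimple.gen K β) : K⟮β⟯) : E) = r j := fun j ↦ by rw [hτ j]
  refine ⟨τ, hτgen, ?_⟩
  -- injective (distinct images of `β`), hence bijective by counting `#Aut ≤ [K(β) : K] = n`
  haveI : FiniteDimensional K K⟮β⟯ := adjoin.finiteDimensional hint
  have hinjτ : Function.Injective τ := by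
    intro j k hjk
    apply hinj
    rw [← hτgen j, ← hτgen k, hjk]
  refine (Fintype.bijective_iff_injective_and_card τ).mpr ⟨hinjτ, le_antisymm ?_ ?_⟩
  · exact Fintype.card_le_of_injective τ hinjτ
  · calc Fintype.card (K⟮β⟯ ≃ₐ[K] K⟮β⟯) ≤ Module.finrank K K⟮β⟯ := AlgEquiv.card_le
      _ = n := by rw [← hdeg, hn]
      _ = Fintype.card (Fin n) := (Fintype.card_fin n).symm

/-- An automorphism acts on polynomial expressions in the generator through its value on the
generator: `τ(p(β)) = p(τβ)`, read in `K̄`. [folklore] -/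
theorem coe_algEquiv_aeval_gen {β : E} (τ : K⟮β⟯ ≃ₐ[K] K⟮β⟯) (p : K[X]) :
    ((τ (aeval (AdjoinSimple.gen K β) p) : K⟮β⟯) : E) =
      aeval ((τ (AdjoinSimple.gen K β) : K⟮β⟯) : E) p := by
  have h1 : τ (aeval (AdjoinSimple.gen K β) p) = aeval (τ (AdjoinSimple.gen K β)) p := by
    rw [aeval_algEquiv]; rfl
  rw [h1]
  exact (IntermediateField.aeval_coe _ _ _).symm

end Literature.NumberTheory.GaloisRepresentations

end
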